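import Mathlib.Topology.Algebra.Module.FiniteDimension
import Literature.NumberTheory.Automorphic.AutomorphicFormsL2Derivative
import HarnessLib

/-!
# Finite-dimensional `K`-stable spaces of smooth functions are stable under the Lie derivatives
# along `𝔨`

Topic `NumberTheory/Automorphic`. Let `H ≤ GL(N, A)` be a linear real group, `ι : H → G` a
homomorphism into a group, `K = H ∩ U(N, A)` its maximal compact subgroup with Lie algebra
`𝔨 = 𝔤 ∩ 𝔲(N, A)` (`RealMatrixGroup.compactLie`), and `V` a FINITE-DIMENSIONAL complex space of
functions `G → ℂ` which are smooth in the archimedean variable and which is stable under the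
right translations `r(k)`, `k ∈ K`. Then `V` is stable under the Lie derivatives `Y ψ`, `Y ∈ 𝔨`
(`lieDeriv_mem_of_k_stable`): `Y ψ` is the pointwise limit of the difference quotients
`t⁻¹ (r(exp tY) ψ - ψ)` (`IsArchSmooth.tendsto_slope_lieDeriv`), which lie in `V` because
`exp tY ∈ K` (`RealMatrixGroup.expK`), and a finite-dimensional subspace of the (Hausdorff
topological vector) space of all functions `G → ℂ` with the topology of pointwise convergence is
closed (Mathlib `Submodule.closed_of_finiteDimensional`). This is the standard remark that the
differential of a finite-dimensional representation of `K` preserves the representation space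
(Borel 1997, 2.16 and 3.7; Knapp 2002, Prop. 1.87 ff.; Harish-Chandra 1953, Lemma 9: `π(𝔛) ψ`
lies in the span of the `K`-translates of a `K`-finite vector `ψ`), for the action on functions
by right translation and the Lie derivatives of `ArchimedeanCalculus`; it is used to show that
`K`-finite `Z(𝔤)`-finite vectors are `Δ`-finite for Nelson's Laplacian
(`AutomorphicRepsGLAnalyticVectors`).

Everything here is proved; no definition.

## References

* Harish-Chandra, *Representations of a semisimple Lie group on a Banach space. I*, Trans. AMS 75
  (1953), 185–243, Lemma 9 (p. 200) [HarishChandraTAMS1953] (held).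
* A. Borel, *Automorphic forms on `SL₂(ℝ)`*, Cambridge Tracts in Math. 130 (1997), 2.16, 3.7
  [Borel1997].
* A. W. Knapp, *Lie Groups Beyond an Introduction*, 2nd ed. (2002), I.§10 [Knapp2002].
-/

open scoped MatrixGroups Matrix Topology
open Filter

noncomputable section

namespace Literature.NumberTheory.Automorphic

variable {A : Type*} [NormedCommRing A] [NormedAlgebra ℝ A] [NormedAlgebra ℚ A] [CompleteSpace A]
  [StarRing A] [StarModule ℝ A] [ContinuousStar A] {N : Type*} [Fintype N] [DecidableEq N]
  {H : RealMatrixGroup A N} {G : Type*} [Group G] (ι : H.carrier →* G)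

omit [ContinuousStar A] in
/-- `𝔨` is closed under real scalars: `t • Y ∈ 𝔨` for `Y ∈ 𝔨` (as matrices). Knapp 2002, VI.§2.
[folklore] -/
theorem smul_coe_mem_compactLie (Y : H.lie) (hY : (Y : Matrix N N A) ∈ H.compactLie) (t : ℝ) :
    t • (Y : Matrix N N A) ∈ H.compactLie := by
  -- Mathlib idiom (Mathlib/Algebra/Lie/OfAssociative.lean): the commutator Lie ring on matrices
  letI : LieRing (Matrix N N A) := LieRing.ofAssociativeRing
  exact H.compactLie.smul_mem t hY

/-- For `Y ∈ 𝔨`, `exp tY ∈ H` is the image of `RealMatrixGroup.expK (t • Y) ∈ K` under `K ≤ H`.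
Knapp 2002, I.§10, Prop. 1.87; VI.§2. [folklore] -/
theorem expMem_smul_eq_inclusion_expK (Y : H.lie) (hY : (Y : Matrix N N A) ∈ H.compactLie) (t : ℝ) :
    H.expMem (t • Y) = Subgroup.inclusion H.maximalCompact_le_carrier
      (H.expK ⟨t • (Y : Matrix N N A), smul_coe_mem_compactLie Y hY t⟩) :=
  Subtype.ext rfl

/-- The right translate `r(exp tY) ψ` of `ψ ∈ V` lies in `V` when `V` is `K`-stable and `Y ∈ 𝔨`.
Harish-Chandra 1953, Lemma 9 (p. 200). [folklore] -/
theorem archTranslate_expMem_smul_mem_of_k_stable {V : Submodule ℂ (G → ℂ)}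
    (hVK : ∀ k : H.maximalCompact, ∀ ψ ∈ V,
      archTranslate ι (Subgroup.inclusion H.maximalCompact_le_carrier k) ψ ∈ V)
    (Y : H.lie) (hY : (Y : Matrix N N A) ∈ H.compactLie) (t : ℝ) {ψ : G → ℂ} (hψ : ψ ∈ V) :
    archTranslate ι (H.expMem (t • Y)) ψ ∈ V := by
  rw [expMem_smul_eq_inclusion_expK Y hY t]
  exact hVK _ ψ hψ

/-- **A finite-dimensional `K`-stable space of smooth functions is `𝔨`-stable.** Let `V` be a
finite-dimensional complex space of functions `G → ℂ`, smooth in the archimedean variable and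
stable under the right translations `r(k)`, `k ∈ K = H ∩ U(N, A)`. Then `Y ψ ∈ V` for every
`ψ ∈ V` and `Y ∈ 𝔨 = 𝔤 ∩ 𝔲(N, A)`: the difference quotients `t⁻¹ (r(exp tY) ψ - ψ) ∈ V` converge
pointwise to `Y ψ` (`IsArchSmooth.tendsto_slope_lieDeriv`), and `V` is closed for the topology
of pointwise convergence (`Submodule.closed_of_finiteDimensional`). Harish-Chandra 1953, Lemma 9
(`π(𝔛)` preserves `∑_{𝔇 ∈ F} ℌ_𝔇` for the differential of the representation of `K`); Borel 1997,
2.16. [cite: HarishChandraTAMS1953, Lemma 9 (p. 200)] -/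
theorem lieDeriv_mem_of_k_stable {V : Submodule ℂ (G → ℂ)} [FiniteDimensional ℂ V]
    (hVK : ∀ k : H.maximalCompact, ∀ ψ ∈ V,
      archTranslate ι (Subgroup.inclusion H.maximalCompact_le_carrier k) ψ ∈ V)
    (hVsm : ∀ ψ ∈ V, IsArchSmooth ι ψ) (Y : H.lie) (hY : (Y : Matrix N N A) ∈ H.compactLie)
    {ψ : G → ℂ} (hψ : ψ ∈ V) : lieDeriv ι Y ψ ∈ V := by
  -- `V` is closed in `G → ℂ` (pointwise convergence)
  have hcl : IsClosed (V : Set (G → ℂ)) := V.closed_of_finiteDimensional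
  -- the difference quotients lie in `V`
  have hmem : ∀ t : ℝ, t⁻¹ • (archTranslate ι (H.expMem (t • Y)) ψ - ψ) ∈ V := fun t ↦
    V.smul_of_tower_mem t⁻¹ (V.sub_mem (archTranslate_expMem_smul_mem_of_k_stable ι hVK Y hY t hψ) hψ)
  -- and converge pointwise to `Y ψ`
  have hlim : Tendsto (fun t : ℝ ↦ t⁻¹ • (archTranslate ι (H.expMem (t • Y)) ψ - ψ)) (𝓝[≠] 0)
      (𝓝 (lieDeriv ι Y ψ)) := by
    rw [tendsto_pi_nhds]
    intro g
    have h := (hVsm ψ hψ).tendsto_slope_lieDeriv ι Y g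
    refine h.congr fun t ↦ ?_
    simp only [Pi.smul_apply, Pi.sub_apply, archTranslate_apply]
  exact hcl.mem_of_tendsto hlim (Eventually.of_forall hmem)

end Literature.NumberTheory.Automorphic
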